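import Mathlib
import Summits.Ventures.PercRepro2.Defs
import Summits.Ventures.PercRepro2.Harris
import Summits.Ventures.PercRepro2.Graph
import Summits.Ventures.PercRepro2.Events
import Summits.Ventures.PercRepro2.Induced
import Summits.Ventures.PercRepro2.SideCluster
import Summits.Ventures.PercRepro2.CactusDefs
import Summits.Ventures.PercRepro2.CactusCluster
import Summits.Ventures.PercRepro2.XorHalf
import Summits.Ventures.PercRepro2.CRForms
import Summits.Ventures.PercRepro2.CRFKG
import Summits.Ventures.PercRepro2.CRClusterLaw

/-!
# (CR) and (XOR) on every triangular cactus (blind cell PercRepro2, mine-a g39; MINE-A.md §94.12)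

mine-c g10's `Cactus.clusterLogSupermod_of_isCactusFrom` (the root-cluster law of a triangular
cactus built from the root satisfies `ClusterLogSupermod`) composed with
`CRClusterLaw.cr_of_clusterLaw_lsm` (as in `CRForest.cr_of_clusterLogSupermod`): (CR) — the hypothesis `hcr` of `CRForms.xorForm_nonneg_of_cr`
— and hence the (XOR) polarisation hold on every triangular cactus, for every `P(R)`.
No definition; one seat.
-/

namespace Summit.Ventures.PercRepro2

namespace CRCactus

open scoped Classical

variable {V : Type*} {E : Type*} [Fintype V] [Fintype E]
  {K : Type*} [Field K] [LinearOrder K] [IsStrictOrderedRing K]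

/-- **(CR) on every triangular cactus.** -/
theorem cr_of_isCactusFrom (p : E → K) (hp : IsProbVec p) {ends : E → Sym2 V} {s : V}
    (h : Cactus.IsCactusFrom ends s Set.univ) (X : Finset V) {𝓤 𝓥 : Set (Set V)}
    (h𝓤 : IsUpperSet 𝓤) (h𝓥 : IsUpperSet 𝓥) :
    let Rv := avoidAll ends s X
    let U := clusterInEvent ends s 𝓤
    let e := clusterInEvent ends s 𝓥
    0 ≤ prob p Rv * prob p (Rvᶜ ∩ U ∩ e) + prob p (Rv ∩ U) * prob p (Rv ∩ e) -
        prob p Rv * prob p U * prob p e :=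
  CRClusterLaw.cr_of_clusterLaw_lsm ends s p hp X h𝓤 h𝓥
    (fun S T => Cactus.clusterLogSupermod_of_isCactusFrom hp h S T)

/-- **(XOR) on every triangular cactus**, for every value of `P(R)`. -/
theorem xorForm_nonneg_of_isCactusFrom (p : E → K) (hp : IsProbVec p) {ends : E → Sym2 V}
    {s : V} (h : Cactus.IsCactusFrom ends s Set.univ) (X : Finset V) {𝓤 𝓥 : Set (Set V)}
    (h𝓤 : IsUpperSet 𝓤) (h𝓥 : IsUpperSet 𝓥) :
    let Rv := avoidAll ends s X
    let U := clusterInEvent ends s 𝓤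
    let e := clusterInEvent ends s 𝓥
    0 ≤ prob p (Rv ∩ U ∩ e) * prob p Rvᶜ + prob p (Rvᶜ ∩ U ∩ e) * prob p Rv -
        prob p (Rv ∩ U) * prob p (Rvᶜ ∩ e) - prob p (Rvᶜ ∩ U) * prob p (Rv ∩ e) :=
  CRForms.xorForm_nonneg_of_cr p hp ends s X h𝓤 h𝓥 (cr_of_isCactusFrom p hp h X h𝓤 h𝓥)

end CRCactus

end Summit.Ventures.PercRepro2
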